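import Summits.RiemannHypothesis.RiemannHypothesis.Theorems.GroundBartaEvenWinsBeyondArchDeflationCertBridgeW
import HarnessLib

/-!
# RiemannHypothesis / GroundBarta — rung 4 (`EvenWinsBeyondArch`): Cauchy–Schwarz box for THREE-zone weighted cross integrals

Helper file (`--supports stmt-RiemannHypothesis-18085`), RH-free, no named facts.  Prover A g12 (unit `sr-gb-rung-a`).
Three-zone twin of `dt_abs_wcross_le_pw` (…CertBridgeW, prover B): for the weight `w = E₅.piecewise a (E₄.piecewise b c)` of the
`{2,3,4,5}`-window R-layer (`wE` on `|y| ≥ y₅`, `wM` on `y₄ ≤ |y| < y₅`, `wI` inside), `|∫ w Re(f ḡ)| ≤ (t·sf + sg/t)/2` from the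
weighted norms — used by the last files of the `c = 83/100` blocks for the cross pairs that are not certified panel by panel.
-/

set_option linter.dupNamespace false

noncomputable section

open MeasureTheory Set Filter
open scoped BigOperators ComplexConjugate

namespace Summit.RiemannHypothesis.RiemannHypothesis.Theorems.EvenWinsBeyondArch

open Literature.NumberTheory.LFunctions

/-- **Cauchy–Schwarz box for a weighted cross integral with a THREE-valued weight**
`w = E₅.piecewise a (E₄.piecewise b c)` (`a, b, c ≥ 0`): `|∫ w Re(f ḡ)| ≤ (t·sf + sg/t)/2` whenever `∫ w‖f‖² ≤ sf`,
`∫ w‖g‖² ≤ sg`, `t > 0` (three-zone twin of `dt_abs_wcross_le_pw`). [folklore] -/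
theorem dt_abs_wcross_le_pw3 {E₅ E₄ : Set ℝ} [DecidablePred (· ∈ E₅)] [DecidablePred (· ∈ E₄)]
    (hE₅ : MeasurableSet E₅) (hE₄ : MeasurableSet E₄) {a b c : ℝ} (ha : 0 ≤ a) (hb : 0 ≤ b) (hc : 0 ≤ c)
    {f g : ℝ → ℂ} (hf : MemLp f 2) (hg : MemLp g 2) {sf sg t : ℝ} (ht : 0 < t)
    (hsf : ∫ y, E₅.piecewise (fun _ ↦ a) (E₄.piecewise (fun _ ↦ b) (fun _ ↦ c)) y * ‖f y‖ ^ 2 ≤ sf)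
    (hsg : ∫ y, E₅.piecewise (fun _ ↦ a) (E₄.piecewise (fun _ ↦ b) (fun _ ↦ c)) y * ‖g y‖ ^ 2 ≤ sg) :
    |∫ y, E₅.piecewise (fun _ ↦ a) (E₄.piecewise (fun _ ↦ b) (fun _ ↦ c)) y * (f y * conj (g y)).re| ≤
      (t * sf + sg / t) / 2 := by
  set w : ℝ → ℝ := E₅.piecewise (fun _ ↦ a) (E₄.piecewise (fun _ ↦ b) (fun _ ↦ c)) with hw
  have hwm : Measurable w :=
    Measurable.piecewise hE₅ measurable_const (Measurable.piecewise hE₄ measurable_const measurable_const)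
  have hwval : ∀ y, w y = a ∨ w y = b ∨ w y = c := fun y ↦ by
    by_cases hy : y ∈ E₅
    · exact Or.inl (by rw [hw, Set.piecewise_eq_of_mem _ _ _ hy])
    · by_cases hy' : y ∈ E₄
      · exact Or.inr (Or.inl (by rw [hw, Set.piecewise_eq_of_notMem _ _ _ hy, Set.piecewise_eq_of_mem _ _ _ hy']))
      · exact Or.inr (Or.inr (by rw [hw, Set.piecewise_eq_of_notMem _ _ _ hy, Set.piecewise_eq_of_notMem _ _ _ hy']))
  have hw0 : ∀ y, 0 ≤ w y := fun y ↦ by rcases hwval y with h | h | h <;> rw [h] <;> assumption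
  have hwC : ∀ y, |Real.sqrt (w y)| ≤ Real.sqrt (a + b + c) := fun y ↦ by
    rw [abs_of_nonneg (Real.sqrt_nonneg _)]
    refine Real.sqrt_le_sqrt ?_
    rcases hwval y with h | h | h <;> rw [h] <;> linarith
  have hft : MemLp (fun y ↦ ((Real.sqrt (w y) : ℝ) : ℂ) * f y) 2 := dt_memLp_real_mul hwm.sqrt hwC hf
  have hgt : MemLp (fun y ↦ ((Real.sqrt (w y) : ℝ) : ℂ) * g y) 2 := dt_memLp_real_mul hwm.sqrt hwC hg
  have e1 : ∫ y, ‖((Real.sqrt (w y) : ℝ) : ℂ) * f y‖ ^ 2 = ∫ y, w y * ‖f y‖ ^ 2 :=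
    integral_congr_ae (Eventually.of_forall fun y ↦ dt_norm_sq_sqrt_mul (hw0 y) (f y))
  have e2 : ∫ y, ‖((Real.sqrt (w y) : ℝ) : ℂ) * g y‖ ^ 2 = ∫ y, w y * ‖g y‖ ^ 2 :=
    integral_congr_ae (Eventually.of_forall fun y ↦ dt_norm_sq_sqrt_mul (hw0 y) (g y))
  have e3 : ∫ y, ((((Real.sqrt (w y) : ℝ) : ℂ) * f y) * conj (((Real.sqrt (w y) : ℝ) : ℂ) * g y)).re =
      ∫ y, w y * (f y * conj (g y)).re :=
    integral_congr_ae (Eventually.of_forall fun y ↦ dt_sqrt_mul_pairing_pt hw0 f g y)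
  have h := dt_abs_cross_le hft hgt (sf := sf) (sg := sg) (t := t) ht (by rw [e1]; exact hsf) (by rw [e2]; exact hsg)
  rwa [e3] at h

end Summit.RiemannHypothesis.RiemannHypothesis.Theorems.EvenWinsBeyondArch

end
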